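import Summits.HodgeConjecture.HodgeConjecture.Theorems.R90S6ResidualStarFixedScalar      -- ★ 3a (brings the FILE-2 star currency: `mem_neighborSet_root_iff_exists_mem_unitaryInt`, `latticeGraphIso_apply_eq_self_iff`, `mapGL_mul_N₁_eq_iff`, …)
import Summits.HodgeConjecture.HodgeConjecture.Theorems.R90S6ResidualUnitaryReduction     -- ★ rung-1a DICTIONARY (this seat): `exists_residualConjugation`, `exists_residual_unitary`, `exists_isotropic_eigenvector_unique_of_pow_three`, §1 letters
import HarnessLib

/-!
# R90 · S6 — LINE G1 «geometric fixed subtree», RUNG 1a (FILE 3u): A RESIDUALLY UNIPOTENT, NOT RESIDUALLY SCALAR `k ∈ K₀` FIXES EXACTLY ONE SPECIAL NEIGHBOUR OF THE ROOT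
# (`Theorems/R90S6ResidualStarFixedUnipotent.lean`)

Cell `hodgecm-mathlib`, crux H413 (`stmt-HodgeConjecture-24833`), route of record `HCCMUnconditional`; programme R90-TF, section S6 (base `R90-C14`), seat R90-C14-p07 (g0);
S6 dealer R90-C14-plan (g2) RULING 2026-09-05T00:29:12Z «p07 TAKES 3u-GENERAL = G1 rung 1a» (the FILE-3 residual VALUE consumed by rung 1
`Theorems/R90S6TorusFixedSpecialCountUnipotent.lean`, sheet `R90/R90-C14-typ1/g2/S6_G1_fixedsubtree_targets.v1.lean` §1 (R1.u)).  Helper lane `--supports stmt-HodgeConjecture-24833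
--as helper`; ONE THEOREM (no definition, no instance, no notation, no named fact, no `sorry`); imports = ★ `Theorems/R90S6ResidualStarFixedScalar` (3a, star currency) + ★
`Theorems/R90S6ResidualUnitaryReduction` (this seat's rung-1a dictionary) + HarnessLib.

THE MATHEMATICS [BruhatTits1972, §10; Tits1979, §3.5; Wilson2009, §3.6.1; Rogawski1990, §3.9 p. 32].  `K` a valued field with an unramified datum `hd : UnramifiedLocalConjDatum σ ϖ`,
`U = U(σ, J₀)(K)`, `K₀ = unitaryInt` the stabiliser of the root `L₀ = 𝒪³`, whose special neighbours (the STAR, `q³ + 1` of them at an inert place) are the residual hyperplanes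
`N_x = {y ∈ 𝒪³ | B₀ x y ∈ 𝔪}` of the primitive residually isotropic `x ∈ 𝒪³` (★ V2a∕V2b), i.e. the isotropic points of the residual hermitian plane `(𝓀³, B̄₀)`; `k ∈ K₀` fixes
`κ·N₁` iff `κe₀` is a residual eigenvector of `k` (★ `mapGL_mul_N₁_eq_iff`).  THE STATEMENT is the sheet's (R1.u) VERBATIM (★ 3a's letters with `hkc ↦ (hN) (hN0)`; NO residual
binders — the residual conjugation `σ̄` is constructed from `hd.vσ`, `hd.σσ` by ★ `exists_residualConjugation`).  THE PROOF: the reduction `k̄ ∈ U(σ̄, J₀)(𝓀)` (★ `exists_residual_unitary`)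
satisfies `(k̄ − c̄)³ = 0` (`hN`, ★ `residue_sub_smul_one_pow_three_eq_zero`) and `k̄ ≠ c̄` (`hN0`), hence has EXACTLY ONE isotropic eigenline `𝓀v̄`
(★ `exists_isotropic_eigenvector_unique_of_pow_three`: norm one of `c̄`, ★ existence, ★ uniqueness, both nilpotency ranks); a primitive lift `x` of `v̄` is residually isotropic
with `kx ≡ cx (mod 𝔪)`, so its residual hyperplane `N_x ∈ star(L₀)` (★ `exists_mem_neighborSet_root_forall_mem_iff`) is `k`-fixed (★ `forall_v_B₀_lt_one_iff_of_exists_unit_congr`);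
conversely a fixed `κ·N₁ ∈ star(L₀)` has `κe₀` a residually isotropic residual eigenvector (★ `mapGL_mul_N₁_eq_iff`; the eigenvalue is `c̄` because `(c̄₁ − c̄)³ v̄′ = (k̄ − c̄)³v̄′ = 0`),
so `κe₀ ≡ a·x (mod 𝔪)` with `a` a unit and `κ·N₁ = N_{κe₀} = N_x` (★ `mem_mapGL_N₁_iff_of_mem_unitaryInt`): **`#{w ∈ star(L₀) : k·w = w} = 1`**.
HONEST LABEL: residual linear algebra over the ★ star dictionary; count-neutral until rung 1 (`R90S6TorusFixedSpecialCountUnipotent`) and the E1.3.5.2 assembly consume it;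
proves no printed statement.  HC_CM is proved only modulo the 7 printed citations (2 remaining named inputs: hLiu418 = stmt-HodgeConjecture-24832, h413 =
stmt-HodgeConjecture-24833) until rung 0 closes.

## References
* [BruhatTits1972] F. Bruhat, J. Tits, *Groupes réductifs sur un corps local I*, Publ. Math. IHÉS 41 (1972), §10.
* [Tits1979] J. Tits, *Reductive groups over local fields*, PSPM 33.1 (1979), §3.5 (the star of a hyperspecial vertex = the residual building).
* [Wilson2009] R. A. Wilson, *The Finite Simple Groups*, GTM 251 (2009), §3.6.1 p. 67 (unitary transvections).
* [Rogawski1990] J. D. Rogawski, *Automorphic Representations of Unitary Groups in Three Variables*, Ann. of Math. Stud. 123 (1990), §3.9 p. 32.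
-/
set_option autoImplicit false
-- the mandated namespace repeats the single-problem summit's segment (`HodgeConjecture.HodgeConjecture`)
set_option linter.dupNamespace false

noncomputable section

open Literature.NumberTheory.Automorphic Literature.NumberTheory.Automorphic.HermitianLattice Literature.NumberTheory.Automorphic.UnitaryGroup
open Literature.NumberTheory.Automorphic.UnitaryLatticeTree
open scoped Matrix MatrixGroups WithZero Valued

namespace Summit.HodgeConjecture.HodgeConjecture.R90.S6

/-- **G1 RUNG 1a = FILE 3u — A RESIDUALLY UNIPOTENT·`c`, RESIDUALLY NON-SCALAR `k ∈ K₀` FIXES EXACTLY ONE SPECIAL NEIGHBOUR OF THE ROOT: `#{w ∈ star(L₀) | k·w = w} = 1`**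
(★ 3a's letters with `hkc ↦ (hN) (hN0)`, sheet `S6_G1_fixedsubtree_targets.v1` §1 (R1.u) VERBATIM).  For an unramified datum `hd` and `k ∈ K₀ = U(σ,J₀) ∩ GL₃(𝒪)` with
`(k − c·1)³ ≡ 0 (mod 𝔪)` entrywise (`|c| = 1`) and `k ≢ c·1 (mod 𝔪)`: the residual conjugation `σ̄` exists (`exists_residualConjugation`), the reduction `k̄ ∈ U(σ̄, J₀)(𝓀)`
(`exists_residual_unitary`) satisfies `(k̄ − c̄)³ = 0 ≠ k̄ − c̄`, hence has EXACTLY ONE isotropic eigenline `𝓀 v̄` (`exists_isotropic_eigenvector_unique_of_pow_three`: norm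
one of `c̄`, ★ existence, ★ uniqueness); a primitive lift `x` of `v̄` is residually isotropic with `k x ≡ c x`, so its residual hyperplane `N_x ∈ star(L₀)`
(★ `exists_mem_neighborSet_root_forall_mem_iff`) is `k`-fixed (★ `forall_v_B₀_lt_one_iff_of_exists_unit_congr`); conversely a fixed `κ·N₁ ∈ star(L₀)` has `κe₀`
a residually isotropic residual eigenvector (★ `mapGL_mul_N₁_eq_iff`), so `κe₀ ≡ a·x (mod 𝔪)` with `a` a unit and `κ·N₁ = N_{κe₀} = N_x` (★ `mem_mapGL_N₁_iff_of_mem_unitaryInt`).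
[cite: BruhatTits1972, §10] [cite: Tits1979, §3.5] [cite: Wilson2009, §3.6.1 p. 67] [cite: Rogawski1990, §3.9 p. 32] -/
theorem ncard_fixed_neighborSet_root_eq_one_of_residually_unipotent {K : Type*} [Field K] [Valued K ℤᵐ⁰]
    {σ : K →+* K} {ϖ : K} (hd : UnramifiedLocalConjDatum σ ϖ)
    (k : ↥(unitaryGroupOfForm σ ((StdForm.antidiagonal 3).over K))) (hk : k ∈ unitaryInt σ ((StdForm.antidiagonal 3).over K))
    {c : K} (hc : Valued.v c = 1)
    (hN : ∀ i j, Valued.v (((((k : GL (Fin 3) K) : Matrix (Fin 3) (Fin 3) K) - c • (1 : Matrix (Fin 3) (Fin 3) K)) ^ 3) i j) < 1)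
    (hN0 : ∃ i j, Valued.v ((((k : GL (Fin 3) K) : Matrix (Fin 3) (Fin 3) K)) i j - c * (1 : Matrix (Fin 3) (Fin 3) K) i j) = 1) :
    {w : {M : Submodule 𝒪[K] (Fin 3 → K) // IsVertex σ ϖ ((StdForm.antidiagonal 3).over K) M} |
        w ∈ (latticeGraph σ ϖ ((StdForm.antidiagonal 3).over K)).neighborSet ⟨stdLattice K 3, 0, isSelfDualLattice_stdLattice_three hd⟩ ∧
          latticeGraphIso σ ϖ ((StdForm.antidiagonal 3).over K) k w = w}.ncard = 1 := by
  classical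
  obtain ⟨hσO, σk, hσk, hσkk⟩ := exists_residualConjugation (K := K) hd.vσ hd.σσ
  obtain ⟨kb, hkb, hkbe, -⟩ := exists_residual_unitary hσO σk hσk hk
  have hu := (mem_unitaryGroupOfForm_antidiagonal_iff (k : GL (Fin 3) K)).1 k.2
  -- integral and residual letters
  set kO : Matrix (Fin 3) (Fin 3) 𝒪[K] :=
    Matrix.of fun i j => (⟨((k : GL (Fin 3) K) : Matrix (Fin 3) (Fin 3) K) i j, (mem_unitaryInt_iff.1 hk).1 i j⟩ : 𝒪[K]) with hkO
  have hCk : kO.map ((↑) : 𝒪[K] → K) = ((k : GL (Fin 3) K) : Matrix (Fin 3) (Fin 3) K) := by ext i j; rfl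
  have hCk' : (𝒪[K].subtype).mapMatrix kO = ((k : GL (Fin 3) K) : Matrix (Fin 3) (Fin 3) K) := by ext i j; rfl
  have hkbO : (kb : Matrix (Fin 3) (Fin 3) 𝓀[K]) = kO.map (IsLocalRing.residue 𝒪[K]) := by ext i j; rw [hkbe]; rfl
  set cO : 𝒪[K] := ⟨c, (Valuation.mem_integer_iff _ _).2 hc.le⟩ with hcO
  have hcb : IsLocalRing.residue 𝒪[K] cO ≠ 0 := by
    rw [Ne, residue_eq_zero_iff_v_lt_one]
    exact fun h => (lt_irrefl _) (hc ▸ h : Valued.v c < Valued.v c)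
  -- `(k̄ − c̄)³ = 0`
  have h3 : ((kb : Matrix (Fin 3) (Fin 3) 𝓀[K]) - IsLocalRing.residue 𝒪[K] cO • (1 : Matrix (Fin 3) (Fin 3) 𝓀[K])) ^ 3 = 0 := by
    rw [hkbO]
    refine residue_sub_smul_one_pow_three_eq_zero kO cO fun i j => ?_
    have hC3 : (𝒪[K].subtype).mapMatrix ((kO - cO • 1) ^ 3) = (((k : GL (Fin 3) K) : Matrix (Fin 3) (Fin 3) K) - c • (1 : Matrix (Fin 3) (Fin 3) K)) ^ 3 := by
      rw [map_pow, map_sub, hCk', subtype_mapMatrix_smul_one]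
    have h := hN i j
    rw [← hC3] at h
    exact h
  -- `k̄ ≠ c̄·1`
  have hne : (kb : Matrix (Fin 3) (Fin 3) 𝓀[K]) ≠ IsLocalRing.residue 𝒪[K] cO • (1 : Matrix (Fin 3) (Fin 3) 𝓀[K]) := by
    obtain ⟨i, j, hij⟩ := hN0
    intro h
    have hij' : (kb : Matrix (Fin 3) (Fin 3) 𝓀[K]) i j - IsLocalRing.residue 𝒪[K] cO * (1 : Matrix (Fin 3) (Fin 3) 𝓀[K]) i j = 0 := by
      rw [h, Matrix.smul_apply, smul_eq_mul, sub_self]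
    have h1 : (1 : Matrix (Fin 3) (Fin 3) 𝓀[K]) i j = IsLocalRing.residue 𝒪[K] ((1 : Matrix (Fin 3) (Fin 3) 𝒪[K]) i j) := by
      rw [Matrix.one_apply, Matrix.one_apply]; split_ifs; · rw [map_one]
      · rw [map_zero]
    rw [hkbe, h1, ← map_mul, ← map_sub, residue_eq_zero_iff_v_lt_one] at hij'
    refine (lt_irrefl (1 : ℤᵐ⁰)) ?_
    have e : (((⟨((k : GL (Fin 3) K) : Matrix (Fin 3) (Fin 3) K) i j, (mem_unitaryInt_iff.1 hk).1 i j⟩ : 𝒪[K]) - cO * (1 : Matrix (Fin 3) (Fin 3) 𝒪[K]) i j :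
        𝒪[K]) : K) = ((k : GL (Fin 3) K) : Matrix (Fin 3) (Fin 3) K) i j - c * (1 : Matrix (Fin 3) (Fin 3) K) i j := by
      push_cast
      rw [Matrix.one_apply, Matrix.one_apply]; split_ifs <;> push_cast <;> rfl
    rw [e, hij] at hij'
    exact hij'
  -- THE unique isotropic eigenline of `k̄`
  obtain ⟨vb, hvb0, hvbfix, hvbiso, huniq⟩ := exists_isotropic_eigenvector_unique_of_pow_three σk hσkk hkb hcb h3 hne
  -- a primitive, residually isotropic lift `x` with `k x ≡ c x`
  obtain ⟨X, hX⟩ : ∃ X : Fin 3 → 𝒪[K], (fun i => IsLocalRing.residue 𝒪[K] (X i)) = vb :=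
    ⟨fun i => (IsLocalRing.residue_surjective (vb i)).choose, funext fun i => (IsLocalRing.residue_surjective (vb i)).choose_spec⟩
  have hx : (fun i => (X i : K)) ∈ stdLattice K 3 := fun i => (Valuation.mem_integer_iff _ _).1 (X i).2
  have hunit : ∃ j, Valued.v ((fun i => (X i : K)) j) = 1 := by
    by_contra hall
    push Not at hall
    apply hvb0
    rw [← hX]
    funext j
    rw [Pi.zero_apply, residue_eq_zero_iff_v_lt_one]
    exact lt_of_le_of_ne ((Valuation.mem_integer_iff _ _).1 (X j).2) (hall j)
  have hiso : Valued.v (B₀ σ 3 (fun i => (X i : K)) (fun i => (X i : K))) < 1 := by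
    rw [← residue_eq_zero_iff_v_lt_one ⟨_, B₀_coe_mem_integer hσO X X⟩, residue_B₀_eq hσO σk hσk, hX, hvbiso]
  have hkx : ∀ i, Valued.v ((((k : GL (Fin 3) K) : Matrix (Fin 3) (Fin 3) K) *ᵥ fun i => (X i : K)) i - c * (X i : K)) < 1 := by
    have h := (residue_vec_eq_smul_iff (kO *ᵥ X) X cO).1 (by rw [residue_mulVec_eq, hX, ← hkbO, hvbfix])
    intro i
    have hi := h i
    rwa [show (((kO *ᵥ X) i : 𝒪[K]) : K) = (((k : GL (Fin 3) K) : Matrix (Fin 3) (Fin 3) K) *ᵥ fun i => (X i : K)) i from by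
      rw [← hCk]; exact congrFun (coe_mulVec_eq kO X) i] at hi
  -- its residual hyperplane `N_x ∈ star(L₀)` …
  obtain ⟨w, hwstar, hwmem⟩ := exists_mem_neighborSet_root_forall_mem_iff hd hx hunit hiso
  -- … is `k`-fixed
  have hstd : ∀ y, (((k : GL (Fin 3) K)⁻¹ : GL (Fin 3) K) : Matrix (Fin 3) (Fin 3) K) *ᵥ y ∈ stdLattice K 3 ↔ y ∈ stdLattice K 3 := by
    intro y
    rw [← mem_mapGL_iff, mapGL_stdLattice_of_mem_unitaryInt hk]
  have hB : ∀ y, B₀ σ 3 (fun i => (X i : K)) ((((k : GL (Fin 3) K)⁻¹ : GL (Fin 3) K) : Matrix (Fin 3) (Fin 3) K) *ᵥ y) =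
      B₀ σ 3 (((k : GL (Fin 3) K) : Matrix (Fin 3) (Fin 3) K) *ᵥ fun i => (X i : K)) y := by
    intro y
    rw [← hu, Matrix.mulVec_mulVec, ← Units.val_mul, mul_inv_cancel, Units.val_one, Matrix.one_mulVec]
  have hkw : latticeGraphIso σ ϖ ((StdForm.antidiagonal 3).over K) k w = w := by
    rw [latticeGraphIso_apply_eq_self_iff]
    ext y
    rw [mem_mapGL_iff, hwmem, hwmem, hstd, hB]
    constructor
    · rintro ⟨hy, hlt⟩
      exact ⟨hy, (forall_v_B₀_lt_one_iff_of_exists_unit_congr hd.vσ ⟨c, hc, hkx⟩ y hy).1 hlt⟩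
    · rintro ⟨hy, hlt⟩
      exact ⟨hy, (forall_v_B₀_lt_one_iff_of_exists_unit_congr hd.vσ ⟨c, hc, hkx⟩ y hy).2 hlt⟩
  -- uniqueness
  rw [Set.ncard_eq_one]
  refine ⟨w, Set.eq_singleton_iff_unique_mem.2 ⟨⟨hwstar, hkw⟩, fun w' hw' => ?_⟩⟩
  obtain ⟨hw'star, hkw'⟩ := hw'
  obtain ⟨κ, hκ, hw'1⟩ := (mem_neighborSet_root_iff_exists_mem_unitaryInt hd w').1 hw'star
  rw [latticeGraphIso_apply_eq_self_iff, hw'1] at hkw'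
  obtain ⟨c₁, hc₁, hc₁x⟩ := (mapGL_mul_N₁_eq_iff hd.vσ hd.vϖ hk hκ).1 hkw'
  -- the first column `x' = κ e₀` of `κ`, in integral letters, and its reduction `v̄'`
  obtain ⟨κb, -, hκbe, -⟩ := exists_residual_unitary hσO σk hσk hκ
  set X' : Fin 3 → 𝒪[K] := fun i => (⟨((κ : GL (Fin 3) K) : Matrix (Fin 3) (Fin 3) K) i 0, (mem_unitaryInt_iff.1 hκ).1 i 0⟩ : 𝒪[K]) with hX'
  have hx'e : (fun i => (X' i : K)) = ((κ : GL (Fin 3) K) : Matrix (Fin 3) (Fin 3) K) *ᵥ Pi.single 0 1 := by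
    funext i
    simp [hX', Matrix.mulVec, dotProduct, Pi.single_apply]
  -- `v̄' ≠ 0` (`κ̄` is invertible)
  have hvb'0 : (fun i => IsLocalRing.residue 𝒪[K] (X' i)) ≠ 0 := by
    intro h0
    have h1 : (((κb⁻¹ : GL (Fin 3) 𝓀[K]) : Matrix (Fin 3) (Fin 3) 𝓀[K]) * (κb : Matrix (Fin 3) (Fin 3) 𝓀[K])) 0 0 = 1 := by
      rw [← Units.val_mul, inv_mul_cancel, Units.val_one, Matrix.one_apply_eq]
    rw [Matrix.mul_apply] at h1
    have hcol : ∀ i, (κb : Matrix (Fin 3) (Fin 3) 𝓀[K]) i 0 = 0 := fun i => by rw [hκbe]; exact congrFun h0 i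
    simp only [hcol, mul_zero, Finset.sum_const_zero] at h1
    exact zero_ne_one h1
  -- `k̄ v̄' = c̄₁ v̄'`
  set c₁O : 𝒪[K] := ⟨c₁, (Valuation.mem_integer_iff _ _).2 hc₁.le⟩ with hc₁O
  have hfix₁ : (kb : Matrix (Fin 3) (Fin 3) 𝓀[K]) *ᵥ (fun i => IsLocalRing.residue 𝒪[K] (X' i)) =
      IsLocalRing.residue 𝒪[K] c₁O • (fun i => IsLocalRing.residue 𝒪[K] (X' i)) := by
    rw [hkbO, ← residue_mulVec_eq]
    refine (residue_vec_eq_smul_iff (kO *ᵥ X') X' c₁O).2 fun i => ?_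
    have e : (((kO *ᵥ X') i : 𝒪[K]) : K) =
        (((k : GL (Fin 3) K) : Matrix (Fin 3) (Fin 3) K) * ((κ : GL (Fin 3) K) : Matrix (Fin 3) (Fin 3) K)) i 0 := by
      rw [Matrix.mul_apply]
      simp only [Matrix.mulVec, dotProduct]
      push_cast
      rfl
    rw [e]
    exact hc₁x i
  -- `c̄₁ = c̄` (else `(k̄ − c̄)³ v̄' = (c̄₁ − c̄)³ v̄' ≠ 0`)
  have hc₁c : IsLocalRing.residue 𝒪[K] c₁O = IsLocalRing.residue 𝒪[K] cO := by
    by_contra hne₁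
    apply hvb'0
    have hT : ∀ n : ℕ, (((kb : Matrix (Fin 3) (Fin 3) 𝓀[K]) - IsLocalRing.residue 𝒪[K] cO • (1 : Matrix (Fin 3) (Fin 3) 𝓀[K])) ^ n) *ᵥ
        (fun i => IsLocalRing.residue 𝒪[K] (X' i)) =
          (IsLocalRing.residue 𝒪[K] c₁O - IsLocalRing.residue 𝒪[K] cO) ^ n • (fun i => IsLocalRing.residue 𝒪[K] (X' i)) := by
      intro n
      induction n with
      | zero => rw [pow_zero, pow_zero, Matrix.one_mulVec, one_smul]
      | succ n ih =>
        rw [pow_succ, ← Matrix.mulVec_mulVec, Matrix.sub_mulVec, Matrix.smul_mulVec, Matrix.one_mulVec, hfix₁, ← sub_smul, Matrix.mulVec_smul, ih,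
          smul_smul, pow_succ']
    have h := hT 3
    rw [h3, Matrix.zero_mulVec] at h
    exact (smul_eq_zero.1 h.symm).resolve_left (pow_ne_zero 3 (sub_ne_zero.2 hne₁))
  rw [hc₁c] at hfix₁
  -- `v̄'` is isotropic: `B₀ (κe₀) (κe₀) = B₀ e₀ e₀ = 0`
  have huκ := (mem_unitaryGroupOfForm_antidiagonal_iff (κ : GL (Fin 3) K)).1 κ.2
  have hx'iso : B₀ σk 3 (fun i => IsLocalRing.residue 𝒪[K] (X' i)) (fun i => IsLocalRing.residue 𝒪[K] (X' i)) = 0 := by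
    have h0 : B₀ σ 3 (fun i => (X' i : K)) (fun i => (X' i : K)) = 0 := by
      rw [hx'e, huκ, B₀_single_left]
      simp
    rw [← residue_B₀_eq hσO σk hσk X' X', show (⟨_, B₀_coe_mem_integer hσO X' X'⟩ : 𝒪[K]) = 0 from Subtype.ext h0, map_zero]
  -- hence on the line of `v̄`: `x' ≡ a·x (mod 𝔪)` with `a` a unit
  obtain ⟨ab, hab⟩ := huniq _ hfix₁ hx'iso
  obtain ⟨aO, haO⟩ := IsLocalRing.residue_surjective ab
  have haO1 : Valued.v (aO : K) = 1 := by
    refine le_antisymm ((Valuation.mem_integer_iff _ _).1 aO.2) (not_lt.1 fun hlt => hvb'0 ?_)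
    rw [hab, ← haO, (residue_eq_zero_iff_v_lt_one aO).2 hlt, zero_smul]
  have hx'x : ∀ i, Valued.v ((X' i : K) - aO * X i) < 1 :=
    (residue_vec_eq_smul_iff X' X aO).1 (by rw [haO, hX, ← hab])
  have hB' := forall_v_B₀_lt_one_iff_of_exists_unit_congr (N := 3) (σ := σ) hd.vσ ⟨(aO : K), haO1, hx'x⟩
  -- `B₀ x' y = (κ⁻¹ y)₂`
  have hBx' : ∀ y, B₀ σ 3 (fun i => (X' i : K)) y =
      ((((κ⁻¹ : ↥(unitaryGroupOfForm σ ((StdForm.antidiagonal 3).over K))) : GL (Fin 3) K) : Matrix (Fin 3) (Fin 3) K) *ᵥ y) 2 := by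
    intro y
    have h := huκ (Pi.single 0 1) ((((κ : GL (Fin 3) K)⁻¹ : GL (Fin 3) K) : Matrix (Fin 3) (Fin 3) K) *ᵥ y)
    rw [Matrix.mulVec_mulVec, ← Units.val_mul, mul_inv_cancel, Units.val_one, Matrix.one_mulVec, B₀_single_left] at h
    rw [hx'e, Subgroup.coe_inv, h]
    rfl
  -- conclude `w' = N_{x'} = N_x = w`
  apply Subtype.ext
  rw [hw'1]
  ext y
  rw [mem_mapGL_N₁_iff_of_mem_unitaryInt hd.vϖ hκ, ← hBx', hwmem]
  constructor
  · rintro ⟨hy, hlt⟩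
    exact ⟨hy, (hB' y hy).1 hlt⟩
  · rintro ⟨hy, hlt⟩
    exact ⟨hy, (hB' y hy).2 hlt⟩

end Summit.HodgeConjecture.HodgeConjecture.R90.S6

end
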